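import Literature.NumberTheory.Rogawski1990.ArchEPGeneratorRegular              -- ★ (7) F7′ (LH3-p04 (g7)) p852141: `exists_onePlaceBump_eq_one` pattern, `chartOrbGLoc_ofReal`, `sum_perm_chartOrbGLoc_comp_perm`,
                                                                                --   `sum_perm_chartOrbGLoc_congr_of_circleExp_eq`, `bzClassMapG_apply_of_not_mem`; brings ★ E1 `EPGeneratorAt`, ★ engine `contDiffOn_chartOrbGLoc_of_uniformlyProper`
import Literature.NumberTheory.Automorphic.ArchSpectralSignatureVanishing      -- ★ (8e′)(α) (F0P3a-p02 (g23)) p852236: `exists_nhds_forall_conj_gprimeBlockAt_not_mem` (the vanishing neighbourhood: bad arrangements and split labels read `0`)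
import Literature.NumberTheory.Rogawski1990.ArchWallClassTubeG               -- ★ (8e′)(β) (F0P2-p02 (g21)) p852232: `exists_wallTube_bzClassMapG_of_not_mem`, `exists_wallTube_bzClassMapG_of_mem` (the wall class tubes)
import Literature.NumberTheory.Automorphic.ArchInnerFormCompactWallProper      -- ★ (8e′)(γ) (LH10-p02 (g9)) p852257: `contDiffOn_chartOrbGLoc_cpt_of_slot_two_simple`, `chartOrbGLoc_ofReal_re_pos_of_slot_two_simple`, `isOpen_setOf_slot_two_simple`
import Literature.Analysis.Calculus.WallClassEmbedding                          -- ★ (GT) (LH10-p02 (g9)) p852123: `exists_contDiffOn_comp_wallClass_of_swap` (swap-symmetric wall germs factor through the class)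
import HarnessLib

/-!
# The ONE-PLACE EULER–POINCARÉ GENERATOR AT A WALL CLASS — brick (8) of N8-INNER ROAD B, read at the COMPACT-WALL representative (Rogawski 1990 §8.2; Shelstad 1979 §4)

Topic `NumberTheory/Rogawski1990`; namespace `Literature.NumberTheory.Rogawski1990`.  THEOREMS only (no `def`, no instance, no axiom, no `sorry`).  Cell `pub/hodgecm-mathlib`, crux
H413 (`stmt-HodgeConjecture-24833`), F0∕P3c road «N8-INNER» ROAD B, brick (8) «WALL EP GENERATOR (one place)» (binder LH1-p01 (g12); ruling LH2-plan (g1) 2026-09-02 17:02:37Z on LHref-N (g4)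
BOX #44∕#45: the wall class `{u,u,v}` is read at the representative with the repeated phase on the two EVEN lines; sigsheet `F0/P3c/LH1/LH1-p01/g12/brick8/SIGSHEET-8e-compact.v1.LH1p01g12.md`).

THE POINT.  For `u ≠ v` on the unit circle the base class `b = esymm3 (u,u,v)` is a WALL class of the compact Cartan of `U(α)_w ≅ U(2,1)`.  Among its three torus representatives
(up to `S₃`) the one with the repeated phase `u` on the slots `0, 1` — which the chart ★ `gprimeBlockAt` places on the two lines of the SAME sign (★ `sign_apply_lineOf`) — has the
COMPACT centraliser `U(2) × U(1) ⊇ Stab(e_{τ2})`; the orbital integral of a one-place test function supported near that point `s` is smooth ACROSS the wall (Harish-Chandra's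
compactness lemma ★ `uniformlyProper_gprimeBlock_cpt_of_ne` at the simple slot `2`, fed to the engine ★ `contDiffOn_chartOrbGLoc_of_uniformlyProper`), while the readings at the
two indefinite representatives and at every SPLIT chart point of a nearby class VANISH identically (one eigenvector inequality near `s`, ★ `exists_nhds_forall_conj_gprimeBlockAt_not_mem`).
* §1 `exists_onePlaceBump_eq_one_of_mem_nhds` — the (KN)-class bump of ★ `exists_onePlaceBump_eq_one` with support inside a prescribed neighbourhood;
* §2 `chartOrbGLoc_eq_zero_of_forall_conj` — a reading all of whose conjugates miss the support is `0`;
* §3 `epGeneratorAt_esymm3_wall` — `EPGeneratorAt L α w ν_w (esymm3 (u,u,v))` for `u ≠ v : Circle`.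
HONEST LABEL: HC_CM is proved only modulo the 7 printed citations (2 remaining: hLiu418 = `stmt-HodgeConjecture-24832`, h413 = `stmt-HodgeConjecture-24833`) until rung 0 closes; count-neutral.

## References

* [Rogawski1990] J. D. Rogawski, *Automorphic Representations of Unitary Groups in Three Variables*, Ann. of Math. Stud. 123 (1990), §3.6 p. 28, §4.12 Lemma 4.12.1 p. 66, §8.2 pp. 118–123.
* [Shelstad1979] D. Shelstad, *Characters and inner forms of a quasi-split group over ℝ*, Compositio Math. 39 (1979), §4 pp. 22–26, Lemma 4.2 p. 23.
* [HarishChandra1970] Harish-Chandra, *Harmonic analysis on reductive p-adic groups* ∕ *Invariant eigendistributions*, Part I §3 Lemma 22 (the compactness lemma).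
* [Varadarajan1989] V. S. Varadarajan, *An Introduction to Harmonic Analysis on Semisimple Lie Groups* (1989), §2.4 Thm. 8.
* [Bouaziz1994IntegralesOrbitales] A. Bouaziz, *Intégrales orbitales sur les groupes de Lie réductifs*, Ann. Sci. ÉNS (4) 27 (1994), §6.2 pp. 591–594.
* [Borel1972] A. Borel, *Représentations de groupes localement compacts*, LNM 276 (1972), 3.4.
-/

set_option autoImplicit false

noncomputable section

open MeasureTheory MeasureTheory.Measure NumberField NumberField.InfinitePlace Matrix Complex Topology Metric Set Function
open Literature.MeasureTheory.Group Literature.NumberTheory.Automorphic Literature.NumberTheory.Automorphic.UnitaryGroup Literature.NumberTheory.Automorphic.ArchCartan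
open scoped MatrixGroups Matrix ContDiff Classical ENNReal Matrix.Norms.Operator

namespace Literature.NumberTheory.Rogawski1990

/-! ## §1 A non-negative one-place test function with value `1` at a prescribed point and support inside a prescribed neighbourhood -/

section Bump

variable (L : Type) [Field L] [NumberField L] [IsCMField L] (α : Fin 3 → L) (w : {w : InfinitePlace L // IsComplex w})

omit [NumberField L] [IsCMField L] in
/-- **A non-negative one-place test function of the (KN) class, `= 1` at `γ₀`, supported inside a prescribed neighbourhood `V` of `↑↑γ₀`** — ★ `exists_onePlaceBump_eq_one` with the
bump radius shrunk into `V`. [cite: Borel1972, 3.4] [cite: Rogawski1990, §8.2 p. 122] -/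
theorem exists_onePlaceBump_eq_one_of_mem_nhds (γ₀ : ↥(archLocal L 3 (Matrix.diagonal α) w)) {V : Set (Matrix (Fin 3) (Fin 3) ℂ)}
    (hV : V ∈ 𝓝 ((((γ₀ : GL (Fin 3) ℂ)) : Matrix (Fin 3) (Fin 3) ℂ))) :
    ∃ f₀ : ↥(archLocal L 3 (Matrix.diagonal α) w) → ℝ, Continuous f₀ ∧ HasCompactSupport f₀ ∧ (∀ g, 0 ≤ f₀ g) ∧ f₀ γ₀ = 1 ∧
      (∀ g, f₀ g ≠ 0 → (((g : GL (Fin 3) ℂ)) : Matrix (Fin 3) (Fin 3) ℂ) ∈ V) ∧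
      ∃ fa : Matrix (Fin 3) (Fin 3) ℂ → ℂ, ContDiff ℝ ∞ fa ∧
        ∀ g : ↥(archLocal L 3 (Matrix.diagonal α) w), ((f₀ g : ℝ) : ℂ) = fa (((g : GL (Fin 3) ℂ)) : Matrix (Fin 3) (Fin 3) ℂ) := by
  -- a ball of invertible matrices around `↑↑γ₀`, inside `V`
  have hopen : IsOpen (Set.range (Units.val : GL (Fin 3) ℂ → Matrix (Fin 3) (Fin 3) ℂ) ∩ interior V) :=
    (Units.isOpenEmbedding_val (R := Matrix (Fin 3) (Fin 3) ℂ)).isOpen_range.inter isOpen_interior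
  obtain ⟨r, hr, hball⟩ := Metric.isOpen_iff.1 hopen (((γ₀ : GL (Fin 3) ℂ)) : Matrix (Fin 3) (Fin 3) ℂ) ⟨⟨(γ₀ : GL (Fin 3) ℂ), rfl⟩, mem_interior_iff_mem_nhds.2 hV⟩
  -- the bump, supported in the closed ball of radius `r ∕ 2`
  let φ : ContDiffBump ((((γ₀ : GL (Fin 3) ℂ)) : Matrix (Fin 3) (Fin 3) ℂ)) := ⟨r / 4, r / 2, by positivity, by linarith⟩
  have hK : IsCompact ((Units.val : GL (Fin 3) ℂ → Matrix (Fin 3) (Fin 3) ℂ) ⁻¹' Metric.closedBall ((((γ₀ : GL (Fin 3) ℂ)) : Matrix (Fin 3) (Fin 3) ℂ)) (r / 2)) := by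
    haveI : ProperSpace (Matrix (Fin 3) (Fin 3) ℂ) := FiniteDimensional.proper ℝ _
    exact (Units.isOpenEmbedding_val (R := Matrix (Fin 3) (Fin 3) ℂ)).isInducing.isCompact_preimage' (isCompact_closedBall _ _)
      (((Metric.closedBall_subset_ball (by linarith)).trans hball).trans Set.inter_subset_left)
  have hK' : IsCompact ((Subtype.val : ↥(archLocal L 3 (Matrix.diagonal α) w) → GL (Fin 3) ℂ) ⁻¹'
      ((Units.val : GL (Fin 3) ℂ → Matrix (Fin 3) (Fin 3) ℂ) ⁻¹' Metric.closedBall ((((γ₀ : GL (Fin 3) ℂ)) : Matrix (Fin 3) (Fin 3) ℂ)) (r / 2))) :=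
    (isClosed_archLocal L 3 (Matrix.diagonal α) w).isClosedEmbedding_subtypeVal.isCompact_preimage hK
  have hKc : IsClosed ((Subtype.val : ↥(archLocal L 3 (Matrix.diagonal α) w) → GL (Fin 3) ℂ) ⁻¹'
      ((Units.val : GL (Fin 3) ℂ → Matrix (Fin 3) (Fin 3) ℂ) ⁻¹' Metric.closedBall ((((γ₀ : GL (Fin 3) ℂ)) : Matrix (Fin 3) (Fin 3) ℂ)) (r / 2))) :=
    (Metric.isClosed_closedBall.preimage Units.continuous_val).preimage continuous_subtype_val
  refine ⟨fun g => φ (((g : GL (Fin 3) ℂ)) : Matrix (Fin 3) (Fin 3) ℂ), φ.continuous.comp (Units.continuous_val.comp continuous_subtype_val),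
    HasCompactSupport.intro' hK' hKc fun g hg => ?_, fun g => φ.nonneg, φ.one_of_mem_closedBall (Metric.mem_closedBall_self (by positivity)), fun g hg => ?_,
    fun M => ((φ M : ℝ) : ℂ), Complex.ofRealCLM.contDiff.comp φ.contDiff, fun g => rfl⟩
  · -- outside the compact set the bump vanishes
    have hdist : r / 2 < dist ((((g : GL (Fin 3) ℂ)) : Matrix (Fin 3) (Fin 3) ℂ)) ((((γ₀ : GL (Fin 3) ℂ)) : Matrix (Fin 3) (Fin 3) ℂ)) := by
      simpa only [Set.mem_preimage, Metric.mem_closedBall, not_le] using hg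
    exact φ.zero_of_le_dist hdist.le
  · -- where the bump is non-zero we are inside the ball of radius `r ∕ 2 < r`, inside `V`
    have hlt : dist ((((g : GL (Fin 3) ℂ)) : Matrix (Fin 3) (Fin 3) ℂ)) ((((γ₀ : GL (Fin 3) ℂ)) : Matrix (Fin 3) (Fin 3) ℂ)) < r / 2 := by
      by_contra hle
      exact hg (φ.zero_of_le_dist (not_lt.1 hle))
    exact interior_subset (hball (Metric.mem_ball.2 (hlt.trans (by linarith)))).2

end Bump

/-! ## §2 A reading all of whose conjugates miss the support vanishes -/

section Zero

variable (L : Type) [Field L] [NumberField L] [IsCMField L] (α : Fin 3 → L) (w : {w : InfinitePlace L // IsComplex w}) (S' : Finset {w : InfinitePlace L // IsComplex w})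
  [MeasurableSpace ↥(archLocal L 3 (Matrix.diagonal α) w)] [BorelSpace ↥(archLocal L 3 (Matrix.diagonal α) w)]
  (νw : Measure ↥(archLocal L 3 (Matrix.diagonal α) w)) [νw.IsHaarMeasure] [νw.IsMulRightInvariant]

/-- **`chartOrbGLoc … f cw = 0` as soon as `f` vanishes at every conjugate `y · gprimeBlockAt cw · y⁻¹`** (the quotient integrand is identically `0`). [cite: Rogawski1990, §8.2 p. 122] -/
theorem chartOrbGLoc_eq_zero_of_forall_conj (f : ↥(archLocal L 3 (Matrix.diagonal α) w) → ℂ) (cw : Fin 3 → ℝ)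
    (hf : ∀ y : ↥(archLocal L 3 (Matrix.diagonal α) w), f (y * gprimeBlockAt L α w S' cw * y⁻¹) = 0) :
    chartOrbGLoc L α w S' νw f cw = 0 := by
  rw [chartOrbGLoc_def]
  have h : descConj (gprimeBlockAt L α w S' cw) (chartTorusGLoc L α w S') (forall_mem_chartTorusGLoc_comm L α w S' cw) f = fun _ => 0 := by
    funext y
    induction y using QuotientGroup.induction_on with
    | H g => rw [descConj_mk, hf]
  rw [h]
  simp only [integral_zero, mul_zero]

end Zero

/-! ## §3 The wall one-place EP generator -/

section Wall

variable (L : Type) [Field L] [NumberField L] [IsCMField L] (α : Fin 3 → L) (w : {w : InfinitePlace L // IsComplex w})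
  [MeasurableSpace ↥(archLocal L 3 (Matrix.diagonal α) w)] [BorelSpace ↥(archLocal L 3 (Matrix.diagonal α) w)]
  (νw : Measure ↥(archLocal L 3 (Matrix.diagonal α) w)) [νw.IsHaarMeasure] [νw.IsMulRightInvariant]

/-- The permutations fixing the slot `2` are `1` and `swap 0 1`. [folklore] -/
private theorem perm_fin_three_apply_two_eq_two_iff (σ : Equiv.Perm (Fin 3)) : σ 2 = 2 ↔ σ = 1 ∨ σ = Equiv.swap 0 1 := by
  revert σ
  decide

/-- **A smooth, swap-symmetric product cutoff on `ℝ³`**: `χ(x) = ψ(x₀)ψ(x₁)ψ(x₂)` for a bump `ψ` at `0 ∈ ℝ`; `= 1` on the cube `‖x‖ ≤ r`, vanishing off the cube `‖x‖ < 2r`,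
topological support inside `ball 0 (3r)` (Hörmander's cutoff between a compact cube and an open one, in product form). [cite: HormanderALPDO1, Thm. 1.4.1] -/
theorem exists_contDiff_cube_cutoff {r : ℝ} (hr : 0 < r) :
    ∃ χ : (Fin 3 → ℝ) → ℝ, ContDiff ℝ ∞ χ ∧ (∀ x, ‖x‖ ≤ r → χ x = 1) ∧ (∀ x, χ x ≠ 0 → ‖x‖ < 2 * r) ∧ tsupport χ ⊆ Metric.ball 0 (3 * r) ∧
      ∀ x, χ (x ∘ Equiv.swap (0 : Fin 3) 1) = χ x := by
  let ψ : ContDiffBump (0 : ℝ) := ⟨r, 2 * r, hr, by linarith⟩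
  refine ⟨fun x => ψ (x 0) * ψ (x 1) * ψ (x 2), ?_, ?_, ?_, ?_, ?_⟩
  · exact ((ψ.contDiff.comp (contDiff_apply ℝ ℝ (0 : Fin 3))).mul (ψ.contDiff.comp (contDiff_apply ℝ ℝ (1 : Fin 3)))).mul
      (ψ.contDiff.comp (contDiff_apply ℝ ℝ (2 : Fin 3)))
  · intro x hx
    have h1 : ∀ k, ψ (x k) = 1 := fun k =>
      ψ.one_of_mem_closedBall (by rw [Metric.mem_closedBall, dist_zero_right]; exact (norm_le_pi_norm x k).trans hx)
    show ψ (x 0) * ψ (x 1) * ψ (x 2) = 1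
    rw [h1, h1, h1, one_mul, one_mul]
  · intro x hx
    replace hx : ψ (x 0) * ψ (x 1) * ψ (x 2) ≠ 0 := hx
    have hk : ∀ k, ψ (x k) ≠ 0 → ‖x k‖ < 2 * r := fun k hk => by
      have hm : x k ∈ Function.support (ψ : ℝ → ℝ) := hk
      rw [ψ.support_eq, Metric.mem_ball, dist_zero_right] at hm
      exact hm
    have h0 : ψ (x 0) ≠ 0 := fun h => hx (by rw [h, zero_mul, zero_mul])
    have h1 : ψ (x 1) ≠ 0 := fun h => hx (by rw [h, mul_zero, zero_mul])
    have h2 : ψ (x 2) ≠ 0 := fun h => hx (by rw [h, mul_zero])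
    rw [pi_norm_lt_iff (by positivity)]
    intro k
    fin_cases k
    · exact hk 0 h0
    · exact hk 1 h1
    · exact hk 2 h2
  · -- the topological support lies in the closed cube of side `2r`, inside the open ball of radius `3r`
    have hsub : Function.support (fun x : Fin 3 → ℝ => ψ (x 0) * ψ (x 1) * ψ (x 2)) ⊆ {x : Fin 3 → ℝ | ‖x‖ ≤ 2 * r} := by
      intro x hx
      have hk : ∀ k, ψ (x k) ≠ 0 → ‖x k‖ < 2 * r := fun k hk => by
        have hm : x k ∈ Function.support (ψ : ℝ → ℝ) := hk
        rw [ψ.support_eq, Metric.mem_ball, dist_zero_right] at hm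
        exact hm
      have hx' : ψ (x 0) * ψ (x 1) * ψ (x 2) ≠ 0 := hx
      have h0 : ψ (x 0) ≠ 0 := fun h => hx' (by rw [h, zero_mul, zero_mul])
      have h1 : ψ (x 1) ≠ 0 := fun h => hx' (by rw [h, mul_zero, zero_mul])
      have h2 : ψ (x 2) ≠ 0 := fun h => hx' (by rw [h, mul_zero])
      show ‖x‖ ≤ 2 * r
      rw [pi_norm_le_iff_of_nonneg (by positivity)]
      intro k
      fin_cases k
      · exact (hk 0 h0).le
      · exact (hk 1 h1).le
      · exact (hk 2 h2).le
    have hcl : IsClosed {x : Fin 3 → ℝ | ‖x‖ ≤ 2 * r} := isClosed_le continuous_norm continuous_const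
    refine (closure_minimal hsub hcl).trans fun x hx => ?_
    rw [Metric.mem_ball, dist_zero_right]
    have hx' : ‖x‖ ≤ 2 * r := hx
    linarith
  · intro x
    show ψ ((x ∘ Equiv.swap (0 : Fin 3) 1) 0) * ψ ((x ∘ Equiv.swap (0 : Fin 3) 1) 1) * ψ ((x ∘ Equiv.swap (0 : Fin 3) 1) 2) = ψ (x 0) * ψ (x 1) * ψ (x 2)
    simp only [Function.comp_apply, Equiv.swap_apply_left, Equiv.swap_apply_right]
    rw [Equiv.swap_apply_of_ne_of_ne (by decide) (by decide), mul_comm (ψ (x 1))]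

set_option maxHeartbeats 400000 in
/-- **THE WALL ONE-PLACE EP GENERATOR**: for a house frame `α` (`α_i ≠ 0`, `σ_w α_i` real) INDEFINITE at the complex place `w`, a Haar measure `ν_w` on `U(α)_w` and a WALL elliptic base class
`b = esymm3 (u, u, v)` (`u ≠ v` on the unit circle), `EPGeneratorAt L α w ν_w b` holds.  Proof at the COMPACT-WALL representative `cw₀ = (θ₀, θ₀, φ₀)` (`u = e^{iθ₀}`, `v = e^{iφ₀}`): `f` is a
one-place bump at `s = gprimeBlockAt α w ∅ cw₀` supported in the neighbourhood `U₀` of ★ `exists_nhds_forall_conj_gprimeBlockAt_not_mem` — so every SPLIT reading of a nearby class and the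
four readings with the near-`u` pair on an indefinite slot pair VANISH (§2); the two surviving slot terms `O(cw) + O(cw ∘ swap 0 1)` are smooth ACROSS the wall on the slot-`2`-simple set
(★ `contDiffOn_chartOrbGLoc_cpt_of_slot_two_simple`: Harish-Chandra's compactness lemma at the simple slot, the engine ★ `contDiffOn_chartOrbGLoc_of_uniformlyProper`) and swap-symmetric, hence a
smooth function `h` of the class by ★ (GT) `exists_contDiffOn_comp_wallClass_of_swap` and the cutoffs ★ `exists_contDiff_eq_one_closedBall_tsupport_subset`; classes `ε`-close to `b` are read
near `cw₀` up to `S₃` and `2π` (★ `exists_wallTube_bzClassMapG_of_not_mem`); `h b = 2·O(cw₀)` has positive real part (★ `chartOrbGLoc_ofReal_re_pos_of_slot_two_simple`).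
[cite: Rogawski1990, §8.2 pp. 122–123; §4.12 Lemma 4.12.1 p. 66] [cite: Shelstad1979, §4 p. 22, Lemma 4.2 p. 23] [cite: HarishChandra1970, Part I §3 Lemma 22] [cite: Bouaziz1994IntegralesOrbitales, §6.2 p. 591] -/
theorem epGeneratorAt_esymm3_wall (hα : ∀ i, α i ≠ 0) (hreal : ∀ i, (w.1.embedding (α i)).im = 0)
    (hind : ¬ (formSign L α w 0 = formSign L α w 1 ∧ formSign L α w 1 = formSign L α w 2)) (u v : Circle) (huv : u ≠ v) :
    EPGeneratorAt L α w νw (esymm3 ![(u : ℂ), u, v]) := by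
  -- ## angles of the base class; the base coordinate `cw₀ = (θ₀, θ₀, φ₀)`
  obtain ⟨θ, hθ⟩ := exists_angles_of_norm_eq_one (l := ![(u : ℂ), u, v]) (fun i => by fin_cases i <;> simp)
  set θ₀ : ℝ := θ 0 with hθ₀def
  set φ₀ : ℝ := θ 2 with hφ₀def
  have hu : (u : ℂ) = Complex.exp ((θ₀ : ℂ) * I) := hθ 0
  have hv : (v : ℂ) = Complex.exp ((φ₀ : ℂ) * I) := hθ 2
  have hne : Complex.exp ((θ₀ : ℂ) * I) ≠ Complex.exp ((φ₀ : ℂ) * I) := by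
    rw [← hu, ← hv]; exact fun h => huv (Subtype.ext h)
  have hne' : Circle.exp φ₀ ≠ Circle.exp θ₀ := fun h => hne (by rw [← Circle.coe_exp, ← Circle.coe_exp, h])
  set base : Fin 3 → ℝ := ![θ₀, θ₀, φ₀] with hbasedef
  have hbase0 : base 0 = θ₀ := rfl
  have hbase1 : base 1 = θ₀ := rfl
  have hbase2 : base 2 = φ₀ := rfl
  have hbase_swap : base ∘ Equiv.swap (0 : Fin 3) 1 = base := by
    funext k; fin_cases k <;> rfl
  set b : ℂ × ℂ × ℂ := esymm3 ![(u : ℂ), u, v] with hb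
  have hluv : (![(u : ℂ), u, v] : Fin 3 → ℂ) = ![Complex.exp ((θ₀ : ℂ) * I), Complex.exp ((θ₀ : ℂ) * I), Complex.exp ((φ₀ : ℂ) * I)] := by
    rw [hu, hv]
  have hbθ : b = esymm3 ![Complex.exp ((θ₀ : ℂ) * I), Complex.exp ((θ₀ : ℂ) * I), Complex.exp ((φ₀ : ℂ) * I)] := by rw [hb, hluv]
  have hbbase : esymm3 (fun k => Complex.exp (((base k : ℝ) : ℂ) * I)) = b := by
    rw [hbθ]; congr 1; funext k; fin_cases k <;> rfl
  -- the base coordinate is slot-`2`-simple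
  have hbaseU : base ∈ {cw : Fin 3 → ℝ | ∀ j, j ≠ 2 → Circle.exp (cw 2) ≠ Circle.exp (cw j)} := by
    intro j hj
    have hj' : base j = θ₀ := by fin_cases j <;> first | rfl | exact absurd rfl hj
    rw [hbase2, hj']; exact hne'
  -- the empty label: compact chart at `w`, admissible
  have hS₀ : ∀ w' : {w : InfinitePlace L // IsComplex w}, w' ∈ (∅ : Finset {w : InfinitePlace L // IsComplex w}) → w' ∈ splitChartPlaces L α :=
    fun w' h => absurd h (Finset.notMem_empty w')
  have hw₀ : w ∉ (∅ : Finset {w : InfinitePlace L // IsComplex w}) := Finset.notMem_empty w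
  have hw₀' : ¬ (w ∈ (∅ : Finset {w : InfinitePlace L // IsComplex w}) ∧ w ∈ splitChartPlaces L α) := fun h => hw₀ h.1
  -- ## (α) the vanishing neighbourhood `U₀` of `s = gprimeBlockAt α w ∅ cw₀`
  obtain ⟨η, hη, U₀, hU₀, hA1, hA2⟩ := exists_nhds_forall_conj_gprimeBlockAt_not_mem L α w hα hreal hind θ₀ φ₀ hne
  -- ## the one-place bump at `s`, supported inside `U₀`
  obtain ⟨f₀, hf₀c, hf₀s, hf₀0, hf₀1, hf₀V, fa, hfa, hfaf⟩ :=
    exists_onePlaceBump_eq_one_of_mem_nhds L α w (gprimeBlockAt L α w (∅ : Finset {w : InfinitePlace L // IsComplex w}) base) hU₀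
  have hfs : HasCompactSupport (fun g : ↥(archLocal L 3 (Matrix.diagonal α) w) => ((f₀ g : ℝ) : ℂ)) := hf₀s.comp_left Complex.ofReal_zero
  -- readings whose conjugates all miss `U₀` vanish
  have hzero : ∀ (S' : Finset {w : InfinitePlace L // IsComplex w}) (cw : Fin 3 → ℝ),
      (∀ y : ↥(archLocal L 3 (Matrix.diagonal α) w),
        (((y * gprimeBlockAt L α w S' cw * y⁻¹ : ↥(archLocal L 3 (Matrix.diagonal α) w)) : GL (Fin 3) ℂ) : Matrix (Fin 3) (Fin 3) ℂ) ∉ U₀) →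
      chartOrbGLoc L α w S' νw (fun g => ((f₀ g : ℝ) : ℂ)) cw = 0 := by
    intro S' cw hmiss
    refine chartOrbGLoc_eq_zero_of_forall_conj L α w S' νw _ cw fun y => ?_
    have h0 : f₀ (y * gprimeBlockAt L α w S' cw * y⁻¹) = 0 := by
      by_contra hne0
      exact hmiss y (hf₀V _ hne0)
    rw [h0, Complex.ofReal_zero]
  -- ## the slot sum `Φ` and the two surviving terms `Ψ`
  set O : (Fin 3 → ℝ) → ℂ := chartOrbGLoc L α w (∅ : Finset {w : InfinitePlace L // IsComplex w}) νw (fun g => ((f₀ g : ℝ) : ℂ)) with hOdef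
  set Φ : (Fin 3 → ℝ) → ℂ := fun cw => ∑ σ : Equiv.Perm (Fin 3), O (cw ∘ σ) with hΦdef
  set Ψ : (Fin 3 → ℝ) → ℂ := fun cw => O cw + O (cw ∘ Equiv.swap (0 : Fin 3) 1) with hΨdef
  have hΦper : ∀ cw cw' : Fin 3 → ℝ, (∀ k, Circle.exp (cw k) = Circle.exp (cw' k)) → Φ cw = Φ cw' :=
    fun cw cw' h => sum_perm_chartOrbGLoc_congr_of_circleExp_eq L α w ∅ νw hw₀ _ h
  have hΦsym : ∀ (cw : Fin 3 → ℝ) (τ : Equiv.Perm (Fin 3)), Φ (cw ∘ τ) = Φ cw :=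
    fun cw τ => sum_perm_chartOrbGLoc_comp_perm L α w ∅ νw _ cw τ
  have hΨsym : ∀ cw : Fin 3 → ℝ, Ψ (cw ∘ Equiv.swap (0 : Fin 3) 1) = Ψ cw := by
    intro cw
    have hcc : (cw ∘ Equiv.swap (0 : Fin 3) 1) ∘ Equiv.swap (0 : Fin 3) 1 = cw := by
      funext k; simp only [Function.comp_apply, Equiv.swap_apply_self]
    show O (cw ∘ Equiv.swap (0 : Fin 3) 1) + O ((cw ∘ Equiv.swap (0 : Fin 3) 1) ∘ Equiv.swap (0 : Fin 3) 1) = O cw + O (cw ∘ Equiv.swap (0 : Fin 3) 1)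
    rw [hcc, add_comm]
  -- smoothness of `Ψ` on the slot-`2`-simple set (★ (γ))
  have hU₂ : IsOpen {cw : Fin 3 → ℝ | ∀ j, j ≠ 2 → Circle.exp (cw 2) ≠ Circle.exp (cw j)} := isOpen_setOf_slot_two_simple
  have hOs : ContDiffOn ℝ ∞ O {cw : Fin 3 → ℝ | ∀ j, j ≠ 2 → Circle.exp (cw 2) ≠ Circle.exp (cw j)} :=
    contDiffOn_chartOrbGLoc_cpt_of_slot_two_simple L α w ∅ νw hα hreal hw₀' fa hfa hfaf hfs
  have hswapc : ContDiff ℝ ∞ fun cw : Fin 3 → ℝ => cw ∘ Equiv.swap (0 : Fin 3) 1 :=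
    contDiff_pi.2 fun k => contDiff_apply ℝ ℝ ((Equiv.swap (0 : Fin 3) 1) k)
  have hswapm : Set.MapsTo (fun cw : Fin 3 → ℝ => cw ∘ Equiv.swap (0 : Fin 3) 1)
      {cw : Fin 3 → ℝ | ∀ j, j ≠ 2 → Circle.exp (cw 2) ≠ Circle.exp (cw j)} {cw : Fin 3 → ℝ | ∀ j, j ≠ 2 → Circle.exp (cw 2) ≠ Circle.exp (cw j)} := by
    intro cw hcw j hj
    simp only [Function.comp_apply]
    rw [Equiv.swap_apply_of_ne_of_ne (by decide) (by decide)]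
    have hj' : Equiv.swap (0 : Fin 3) 1 j ≠ 2 := by
      intro h
      have := congrArg (Equiv.swap (0 : Fin 3) 1) h
      rw [Equiv.swap_apply_self, Equiv.swap_apply_of_ne_of_ne (by decide) (by decide)] at this
      exact hj this
    exact hcw _ hj'
  have hΨs : ContDiffOn ℝ ∞ Ψ {cw : Fin 3 → ℝ | ∀ j, j ≠ 2 → Circle.exp (cw 2) ≠ Circle.exp (cw j)} :=
    hOs.add (hOs.comp hswapc.contDiffOn hswapm)
  -- ## the radii: `δU` (stay slot-`2`-simple), `δ₁` (slot-`2` phases of the bad arrangements stay `η`-close to `u`)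
  obtain ⟨δU, hδU, hballU⟩ := Metric.isOpen_iff.1 hU₂ base hbaseU
  have hcont : ContinuousAt (fun t : ℝ => Complex.exp ((((θ₀ + t : ℝ)) : ℂ) * I)) 0 := by fun_prop
  obtain ⟨δ₁, hδ₁, hδ₁η⟩ := Metric.continuousAt_iff.1 hcont η hη
  have hη' : ∀ t : ℝ, |t| < δ₁ → ‖Complex.exp ((((θ₀ + t : ℝ)) : ℂ) * I) - Complex.exp ((θ₀ : ℂ) * I)‖ ≤ η := by
    intro t ht
    have h := hδ₁η (x := t) (by rwa [dist_zero_right, Real.norm_eq_abs])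
    rw [dist_eq_norm, add_zero] at h
    exact h.le
  set δ₀ : ℝ := min δU δ₁ with hδ₀def
  have hδ₀ : 0 < δ₀ := lt_min hδU hδ₁
  -- near `cw₀` the four bad slot terms vanish and `Φ = Ψ`
  have hbad : ∀ x : Fin 3 → ℝ, ‖x‖ < δ₀ → ∀ σ : Equiv.Perm (Fin 3), σ 2 ≠ 2 → O ((base + x) ∘ σ) = 0 := by
    intro x hx σ hσ
    refine hzero ∅ _ (hA1 ∅ ((base + x) ∘ σ) hw₀' ?_)
    have hσ2 : base (σ 2) = θ₀ := by
      generalize hj : σ 2 = j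
      rw [hj] at hσ
      fin_cases j <;> first | rfl | exact absurd rfl hσ
    have hxk : |x (σ 2)| < δ₁ := by
      have h1 : ‖x (σ 2)‖ ≤ ‖x‖ := norm_le_pi_norm x _
      rw [Real.norm_eq_abs] at h1
      exact h1.trans_lt (hx.trans_le (min_le_right _ _))
    have heq : (((base + x) ∘ σ) 2 : ℝ) = θ₀ + x (σ 2) := by
      show base (σ 2) + x (σ 2) = θ₀ + x (σ 2)
      rw [hσ2]
    rw [heq]
    exact hη' _ hxk
  have hΦΨ : ∀ x : Fin 3 → ℝ, ‖x‖ < δ₀ → Φ (base + x) = Ψ (base + x) := by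
    intro x hx
    show ∑ σ : Equiv.Perm (Fin 3), O ((base + x) ∘ σ) = O (base + x) + O ((base + x) ∘ Equiv.swap (0 : Fin 3) 1)
    rw [Fintype.sum_eq_add (1 : Equiv.Perm (Fin 3)) (Equiv.swap (0 : Fin 3) 1) (by decide) (fun σ hσ => ?_)]
    · rfl
    · exact hbad x hx σ fun h => by
        rcases (perm_fin_three_apply_two_eq_two_iff σ).1 h with h1 | h1
        · exact hσ.1 h1
        · exact hσ.2 h1
  -- ## the swap-symmetric smooth germ `g(x) = χ₃(x) · Ψ(cw₀ + x)` and the (GT) class factorisation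
  obtain ⟨χ₃, hχ₃, hχ₃1, hχ₃0, hχ₃supp, hχ₃sw⟩ := exists_contDiff_cube_cutoff (r := δ₀ / 4) (by positivity)
  have hV₁ : IsOpen (Metric.ball (0 : Fin 3 → ℝ) δ₀) := Metric.isOpen_ball
  have hΨshift : ContDiffOn ℝ ∞ (fun x : Fin 3 → ℝ => Ψ (base + x)) (Metric.ball (0 : Fin 3 → ℝ) δ₀) := by
    refine hΨs.comp ((contDiff_const.add contDiff_id).contDiffOn) fun x hx => hballU ?_
    rw [Metric.mem_ball, dist_eq_norm, add_sub_cancel_left]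
    rw [Metric.mem_ball, dist_zero_right] at hx
    exact hx.trans_le (min_le_left _ _)
  have hsupp₃ : tsupport χ₃ ⊆ Metric.ball (0 : Fin 3 → ℝ) δ₀ := hχ₃supp.trans (Metric.ball_subset_ball (by linarith))
  have hg₀ : ContDiff ℝ ∞ fun x : Fin 3 → ℝ => ((χ₃ x : ℝ) : ℂ) * Ψ (base + x) := contDiff_ofReal_mul_of_tsupport_subset hV₁ hχ₃ hsupp₃ hΨshift
  set g : (Fin 3 → ℝ) × ℝ → ℂ := fun p => ((χ₃ p.1 : ℝ) : ℂ) * Ψ (base + p.1) with hgdef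
  have hg : ContDiff ℝ ∞ g := hg₀.comp contDiff_fst
  have hgswap : ∀ (x : Fin 3 → ℝ) (z : ℝ), g (x ∘ Equiv.swap (0 : Fin 3) 1, z) = g (x, z) := by
    intro x z
    show ((χ₃ (x ∘ Equiv.swap (0 : Fin 3) 1) : ℝ) : ℂ) * Ψ (base + x ∘ Equiv.swap (0 : Fin 3) 1) = ((χ₃ x : ℝ) : ℂ) * Ψ (base + x)
    have hbx : base + x ∘ Equiv.swap (0 : Fin 3) 1 = (base + x) ∘ Equiv.swap (0 : Fin 3) 1 := by
      conv_lhs => rw [← hbase_swap]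
      rfl
    rw [hχ₃sw, hbx, hΨsym]
  obtain ⟨W, hW, hbW, F, hF, δ₃, hδ₃, hGT⟩ := Literature.Analysis.Calculus.exists_contDiffOn_comp_wallClass_of_swap θ₀ φ₀ hne g hg hgswap
  -- the (GT) class data of the offsets `x` are `esymm3 (e^{i (cw₀ + x)})`
  have hS : ∀ x : Fin 3 → ℝ,
      ((Complex.exp ((((θ₀ + x 0 : ℝ)) : ℂ) * I) + Complex.exp ((((θ₀ + x 1 : ℝ)) : ℂ) * I) + Complex.exp ((((φ₀ + x 2 : ℝ)) : ℂ) * I),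
          Complex.exp ((((θ₀ + x 0 : ℝ)) : ℂ) * I) * Complex.exp ((((θ₀ + x 1 : ℝ)) : ℂ) * I) +
              Complex.exp ((((θ₀ + x 0 : ℝ)) : ℂ) * I) * Complex.exp ((((φ₀ + x 2 : ℝ)) : ℂ) * I) +
            Complex.exp ((((θ₀ + x 1 : ℝ)) : ℂ) * I) * Complex.exp ((((φ₀ + x 2 : ℝ)) : ℂ) * I),
          Complex.exp ((((θ₀ + x 0 : ℝ)) : ℂ) * I) * Complex.exp ((((θ₀ + x 1 : ℝ)) : ℂ) * I) * Complex.exp ((((φ₀ + x 2 : ℝ)) : ℂ) * I)) : ℂ × ℂ × ℂ) =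
        esymm3 (fun k => Complex.exp ((((base + x) k : ℝ) : ℂ) * I)) := by
    intro x
    rw [esymm3_apply]
    rfl
  simp only [add_zero] at hbW
  have hbW' : b ∈ W := by
    have h0 := hS 0
    simp only [Pi.add_apply, Pi.zero_apply, add_zero] at h0
    rw [h0, hbbase] at hbW
    exact hbW
  obtain ⟨r, hr, hballW⟩ := Metric.isOpen_iff.1 hW b hbW'
  -- ## the class-side cutoff and the class function `h = χ · F(·, 0)`
  set ε₁ : ℝ := r / 3 with hε₁def
  have hε₁ : 0 < ε₁ := by positivity
  obtain ⟨χ, hχ, hχ1, hχsupp⟩ := exists_contDiff_eq_one_closedBall_tsupport_subset b hε₁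
  have hsuppW : tsupport χ ⊆ W := hχsupp.trans ((Metric.ball_subset_ball (by rw [hε₁def]; linarith)).trans hballW)
  have hF0 : ContDiffOn ℝ ∞ (fun z : ℂ × ℂ × ℂ => F (z, (0 : ℝ))) W :=
    hF.comp (contDiffOn_id.prodMk contDiffOn_const) fun z hz => Set.mk_mem_prod hz (Set.mem_univ _)
  have hh : ContDiff ℝ ∞ fun z : ℂ × ℂ × ℂ => ((χ z : ℝ) : ℂ) * F (z, (0 : ℝ)) := contDiff_ofReal_mul_of_tsupport_subset hW hχ hsuppW hF0
  -- ## (β) the wall class tubes: compact readings near `b` sit near `cw₀` up to `S₃` and `2π`; split readings near `b` have their boost phase near `u`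
  obtain ⟨δc, hδc, htubec⟩ := exists_wallTube_bzClassMapG_of_not_mem (S' := (∅ : Finset {w : InfinitePlace L // IsComplex w})) hw₀ θ₀ φ₀ hne
    (ε := min (δ₀ / 4) δ₃) (lt_min (by positivity) hδ₃)
  set εs : ℝ := min η (‖Complex.exp ((θ₀ : ℂ) * I) - Complex.exp ((φ₀ : ℂ) * I)‖ / 4) with hεsdef
  have hεs : 0 < εs := lt_min hη (div_pos (norm_pos_iff.2 (sub_ne_zero.2 hne)) four_pos)
  have hεs4 : 4 * εs ≤ ‖Complex.exp ((θ₀ : ℂ) * I) - Complex.exp ((φ₀ : ℂ) * I)‖ := by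
    have : εs ≤ ‖Complex.exp ((θ₀ : ℂ) * I) - Complex.exp ((φ₀ : ℂ) * I)‖ / 4 := min_le_right _ _
    linarith
  obtain ⟨δs, hδs, htubes⟩ := exists_wallTube_bzClassMapG_of_mem (S' := ({w} : Finset {w : InfinitePlace L // IsComplex w})) (Finset.mem_singleton_self w)
    θ₀ φ₀ hne hεs hεs4
  -- ## the radius
  set ε : ℝ := min ε₁ (min δc δs) with hεdef
  have hε : 0 < ε := lt_min hε₁ (lt_min hδc hδs)
  refine (epGeneratorAt_iff b).2 ⟨ε, hε, fun g => ((f₀ g : ℝ) : ℂ), ⟨fa, hfa, hfaf⟩, hfs, fun z => ((χ z : ℝ) : ℂ) * F (z, (0 : ℝ)), hh, ?_, ?_, ?_⟩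
  · -- ## `h b ≠ 0`: `h b = g(0) = Ψ(cw₀) = 2·O(cw₀)` has positive real part
    have h1 : χ b = 1 := hχ1 b (Metric.mem_closedBall_self hε₁.le)
    obtain ⟨-, hGT0⟩ := hGT 0 (by rw [norm_zero]; exact hδ₃) 0
    have h00 := hS 0
    simp only [Pi.add_apply, Pi.zero_apply, add_zero] at h00 hGT0
    rw [h00, hbbase] at hGT0
    show ((χ b : ℝ) : ℂ) * F (b, (0 : ℝ)) ≠ 0
    rw [h1, Complex.ofReal_one, one_mul, hGT0]
    show ((χ₃ 0 : ℝ) : ℂ) * Ψ (base + 0) ≠ 0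
    rw [hχ₃1 0 (by rw [norm_zero]; positivity), Complex.ofReal_one, one_mul, add_zero]
    show O base + O (base ∘ Equiv.swap (0 : Fin 3) 1) ≠ 0
    rw [hbase_swap]
    have hpos : 0 < (O base).re :=
      chartOrbGLoc_ofReal_re_pos_of_slot_two_simple L α w ∅ νw hα hreal hS₀ hw₀ hf₀c hf₀s hf₀0 hbaseU (by rw [hf₀1]; exact one_pos)
    intro h0
    have h2 : (O base + O base).re = 0 := by rw [h0, Complex.zero_re]
    rw [Complex.add_re] at h2
    linarith
  · -- ## the split clause: every split reading of a class near `b` vanishes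
    intro S' c hwS hc0 hdist
    have hlab : bzClassMapG ({w} : Finset {w : InfinitePlace L // IsComplex w}) c w = bzClassMapG S' c w := by
      rw [bzClassMapG_apply, bzClassMapG_apply, chartEigG_of_mem (Finset.mem_singleton_self w), chartEigG_of_mem hwS]
    have hd : dist (bzClassMapG ({w} : Finset {w : InfinitePlace L // IsComplex w}) c w)
        (esymm3 ![Complex.exp ((θ₀ : ℂ) * I), Complex.exp ((θ₀ : ℂ) * I), Complex.exp ((φ₀ : ℂ) * I)]) < δs := by
      rw [hlab, ← hbθ]; exact hdist.trans_le ((min_le_right _ _).trans (min_le_right _ _))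
    obtain ⟨hb1, hb2⟩ := htubes c hd
    by_cases hsp : w ∈ splitChartPlaces L α
    · exact hzero S' (c w) (hA2 S' (c w) hwS hsp hc0 (hb1.le.trans (min_le_left _ _)))
    · exact hzero S' (c w) (hA1 S' (c w) (fun h => hsp h.2) (hb2.le.trans (min_le_left _ _)))
  · -- ## the compact clause
    intro S' c hwS _ hdist
    -- the one-place functional of `S′ ∌ w` is that of the empty label
    have hS'0 : (∑ σ : Equiv.Perm (Fin 3), chartOrbGLoc L α w S' νw (fun g => ((f₀ g : ℝ) : ℂ)) (c w ∘ σ)) = Φ (c w) :=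
      Finset.sum_congr rfl fun σ _ => chartOrbGLoc_eq_of_mem_iff L α w νw (iff_of_false hwS hw₀) _ _
    have hzc : bzClassMapG S' c w = esymm3 (fun i => Complex.exp ((c w i : ℂ) * I)) := bzClassMapG_apply_of_not_mem L w c hwS
    -- the tube: `c w` is `cw₀ + x` up to `S₃` and `2π`, `‖x‖ < min (δ₀/4) δ₃`
    have hlab : bzClassMapG (∅ : Finset {w : InfinitePlace L // IsComplex w}) c w = bzClassMapG S' c w := by
      rw [bzClassMapG_apply_of_not_mem L w c hw₀, hzc]
    have hd : dist (bzClassMapG (∅ : Finset {w : InfinitePlace L // IsComplex w}) c w)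
        (esymm3 ![Complex.exp ((θ₀ : ℂ) * I), Complex.exp ((θ₀ : ℂ) * I), Complex.exp ((φ₀ : ℂ) * I)]) < δc := by
      rw [hlab, ← hbθ]; exact hdist.trans_le ((min_le_right _ _).trans (min_le_left _ _))
    obtain ⟨π, x, hxn, hπx⟩ := htubec c hd
    have hx4 : ‖x‖ < δ₀ / 4 := hxn.trans_le (min_le_left _ _)
    have hxδ₀ : ‖x‖ < δ₀ := hx4.trans (by linarith)
    have hxδ₃ : ‖x‖ < δ₃ := hxn.trans_le (min_le_right _ _)
    have hphase : ∀ k, Circle.exp ((c w ∘ ⇑π) k) = Circle.exp ((base + x) k) := fun k => hπx k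
    have hcoe : ∀ k, Complex.exp ((((base + x) k : ℝ) : ℂ) * I) = Complex.exp (((c w (π k) : ℝ) : ℂ) * I) := fun k => by
      have h := congrArg Subtype.val (hπx k)
      rw [Circle.coe_exp, Circle.coe_exp] at h
      exact h.symm
    have hesymm : esymm3 (fun k => Complex.exp ((((base + x) k : ℝ) : ℂ) * I)) = bzClassMapG S' c w := by
      rw [hzc, show (fun k => Complex.exp ((((base + x) k : ℝ) : ℂ) * I)) = (fun i => Complex.exp (((c w i : ℝ) : ℂ) * I)) ∘ ⇑π from funext hcoe,
        esymm3_comp_equiv]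
    have h1 : χ (bzClassMapG S' c w) = 1 := hχ1 _ (Metric.mem_closedBall.2 (hdist.le.trans (min_le_left _ _)))
    rw [hS'0]
    show Φ (c w) = ((χ (bzClassMapG S' c w) : ℝ) : ℂ) * F (bzClassMapG S' c w, (0 : ℝ))
    rw [h1, Complex.ofReal_one, one_mul]
    calc Φ (c w) = Φ (c w ∘ ⇑π) := (hΦsym _ π).symm
      _ = Φ (base + x) := hΦper _ _ hphase
      _ = Ψ (base + x) := hΦΨ x hxδ₀
      _ = g (x, 0) := by
          show Ψ (base + x) = ((χ₃ x : ℝ) : ℂ) * Ψ (base + x)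
          rw [hχ₃1 x hx4.le, Complex.ofReal_one, one_mul]
      _ = _ := ((hGT x hxδ₃ 0).2).symm
      _ = F (bzClassMapG S' c w, (0 : ℝ)) := by rw [hS x, hesymm]

/-- **THE SAME AT A SPLIT-CHART PLACE** — the consumer form: `w ∈ splitChartPlaces L α` carries both the reality of `σ_w α` and the indefiniteness of the line signs (★ `splitChartPlaces`:
`formRe (τ0) · formRe (τ2) < 0`); at `β₀ = (½, 1, −½)` every complex place qualifies (★ `mem_splitChartPlaces_quasiSplitWeights`). [cite: Rogawski1990, §3.6 p. 31; §8.2 p. 122] -/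
theorem epGeneratorAt_esymm3_wall_of_mem_splitChartPlaces (hα : ∀ i, α i ≠ 0) (hwsp : w ∈ splitChartPlaces L α) (u v : Circle) (huv : u ≠ v) :
    EPGeneratorAt L α w νw (esymm3 ![(u : ℂ), u, v]) := by
  refine epGeneratorAt_esymm3_wall L α w νw hα hwsp.1 ?_ u v huv
  rintro ⟨h01, h12⟩
  have hall : ∀ j : Fin 3, formSign L α w j = formSign L α w 0 := fun j => by
    fin_cases j
    · rfl
    · exact h01.symm
    · exact (h01.trans h12).symm
  have hneg := hwsp.2
  have hs : formSign L α w (lineOf (formSign L α w) 0) = formSign L α w (lineOf (formSign L α w) 2) := by rw [hall, ← hall (lineOf (formSign L α w) 2)]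
  have hs' : SignType.sign (formRe L α w (lineOf (formSign L α w) 0)) = SignType.sign (formRe L α w (lineOf (formSign L α w) 2)) := hs
  rcases mul_neg_iff.1 hneg with ⟨ha, hb⟩ | ⟨ha, hb⟩
  · rw [sign_pos ha, sign_neg hb] at hs'
    exact absurd hs' (by decide)
  · rw [sign_neg ha, sign_pos hb] at hs'
    exact absurd hs' (by decide)

end Wall

end Literature.NumberTheory.Rogawski1990

end
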